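import Literature.Geometry.ComplexHyperbolic.UnitBallU21
import Mathlib.Analysis.SpecialFunctions.Complex.Circle
import HarnessLib

/-!
# (β) The χ-line data of ★ `UnitBallKCentralTransversalLineJetsBridge` at the REPRESENTATIVE POINT `W = (s, 0)`, `r₀ = s`, `b = 3∕(2s)`: the slot table in the constant matrices
# `1, iP, P, V₀, T` of ★ `UnitBallCentreValueInputs` (Rogawski 1990 §8.4 pp. 126–127; Goldman 1999 §3.1.1)

Topic `Geometry/ComplexHyperbolic`; namespace `Literature.Geometry.ComplexHyperbolic.BallModel.RepresentativeSlots`.  THEOREMS ONLY (no `def`, no instance, no notation, no axiom,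
no named fact, no `sorry`).  Cell `pub/hodgecm-mathlib`, ENGINE T1 (crux H413 = `stmt-HodgeConjecture-24833`); ROAD A, (A4-iii) «THE VALUE», brick (β) «POINTWISE χ-JET IDENTITY at
`W = s•ω`» (ROAD A owner WORD R-14.8, 2026-09-01T13:31:55Z; census `F0/P3a/A-p18/g26/CENSUS-beta-ChiJetRepresentativePoint.A-p18g26.md`), first deliverable (β2-slots).
Author A-p18 (g26), 2026-09-01.

WHAT THIS IS.  A-p14's χ-bridge (★ `fderiv_fderiv_transversalDatum_apply_eq`, `fderiv_transversalDatum_apply_eq`) expresses the `t`-jets of the transversal datum `Λ_χ` at `t = 0` through the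
line data `h 0, h₁ 0, h₂ 0, P 0, P₁ 0, P₂` (rfl-hypotheses) built from `u_t = ζe^{it}`, `x = (W₀, W₁, r₀ + tb)`, `N = x x* J`.  At the representative point of p06's LEAN FRAME — `W = (s, 0)`,
`r₀ = s` (the wall value `√nsq W`), `b = 3∕(2s)` — every one of them is a combination of the CONSTANT matrices of ★ `UnitBallCentreValueInputs` with coefficients polynomial in `s, s⁻¹` and
one factor `ζ`:
* §1 `nsq (s,0) = s²`; `x₀x₀*J = s²•P` (`P = E₀₀ − E₀₂ + E₂₀ − E₂₂`, `iP = (!![i,0,−i;0,0,0;i,0,−i] : Matrix (Fin 3) (Fin 3) ℂ)`); `(x̂e₂* + e₂x̂*)J = s•(E₂₀ − E₀₂)`; `e₂e₂*J = −E₂₂ = T`;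
* §2 `P 0 = s²•P`, `P₁ 0 = 3•1 + (3∕2)•V₀` (`V₀ = E₂₀ − E₀₂ − 2E₂₂`), `P₂ = (9∕(2s²))•(1 − E₂₂)`, `h 0 = ζ•(1 + s²•iP)` (p06's base point `M₀(s)`),
  `h₁ 0 = ζ•(i•1 + (3i∕2)•V₀ + (s²∕2)•P)`, `h₂ 0 = ζ•(−1 + (3∕2)•V₀ − (s²∕4)•iP − (9i∕(2s²))•E₂₂)`; the scalars `u₀ = ζ`, `iζe^{−0∕2·i} = iζ`.
So (β2) — the χ″(0⁺)-density at the representative point as jets of `Ψ = Θ∘(ζ•)` at `M₀(s)` against p06's matrices — is these identities + multilinearity (next file ∕ p06's generator).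
HONEST LABEL: matrix arithmetic; pays nothing by itself (HC_CM is proved only modulo the printed citations until rung 0 closes).

## References
* [Rogawski1990] J. D. Rogawski, *Automorphic Representations of Unitary Groups in Three Variables*, Ann. of Math. Stud. 123 (1990), §8.4 pp. 126–127.
* [Goldman1999] W. M. Goldman, *Complex Hyperbolic Geometry* (1999), §3.1.1 (the Hermitian form, `N(x) = xx*J`).
-/

set_option autoImplicit false
set_option linter.unusedSimpArgs false
set_option linter.unusedTactic false
set_option linter.unreachableTactic false
set_option linter.unnecessarySeqFocus false

noncomputable section

open Matrix Complex
open scoped ComplexConjugate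

namespace Literature.Geometry.ComplexHyperbolic.BallModel.RepresentativeSlots

/-! ## §1 The building blocks at `W = (s, 0)`, `r₀ = s` -/

/-- `nsq (s, 0) = s²` for real `s`. [cite: Goldman1999, §3.1.1] -/
theorem nsq_rep (s : ℝ) : nsq ![(s : ℂ), 0] = s ^ 2 := by
  simp [nsq, Complex.norm_real, sq_abs]

/-- `N(x₀) = x₀x₀*J = s²•P` for `x₀ = (s, 0, s)`, `P = E₀₀ − E₀₂ + E₂₀ − E₂₂`. [cite: Goldman1999, §3.1.1] -/
theorem vecMulVec_rep_mul_J (s : ℝ) :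
    vecMulVec ![(s : ℂ), 0, (s : ℂ)] (star ![(s : ℂ), 0, (s : ℂ)]) * J = ((s ^ 2 : ℝ) : ℂ) • (!![(1 : ℂ), 0, -1; 0, 0, 0; 1, 0, -1] : Matrix (Fin 3) (Fin 3) ℂ) := by
  ext i j
  fin_cases i <;> fin_cases j <;>
    simp [J, Matrix.mul_apply, Matrix.add_apply, Fin.sum_univ_three, Complex.ext_iff, -Complex.ofReal_div, -Complex.ofReal_mul, -Complex.ofReal_inv,
      -Complex.ofReal_pow, -Complex.ofReal_sub, -Complex.ofReal_add, -Complex.ofReal_neg, -Complex.ofReal_ofNat, -Complex.ofReal_natCast, -Complex.ofReal_one,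
      -Complex.ofReal_zero] <;> (try constructor) <;> (try field_simp) <;> (try ring)

/-- The wall pair `(x̂e₂* + e₂x̂*)J = s•(E₂₀ − E₀₂)` for `x̂ = (s, 0, 0)`. [cite: Goldman1999, §3.1.1] -/
theorem wallPair_rep_mul_J (s : ℝ) :
    (vecMulVec ![(s : ℂ), 0, 0] (star ![(0 : ℂ), 0, 1]) + vecMulVec ![(0 : ℂ), 0, 1] (star ![(s : ℂ), 0, 0])) * J = ((s : ℝ) : ℂ) • (!![(0 : ℂ), 0, -1; 0, 0, 0; 1, 0, 0] : Matrix (Fin 3) (Fin 3) ℂ) := by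
  ext i j
  fin_cases i <;> fin_cases j <;>
    simp [J, Matrix.mul_apply, Matrix.add_apply, Fin.sum_univ_three, Complex.ext_iff, -Complex.ofReal_div, -Complex.ofReal_mul, -Complex.ofReal_inv,
      -Complex.ofReal_pow, -Complex.ofReal_sub, -Complex.ofReal_add, -Complex.ofReal_neg, -Complex.ofReal_ofNat, -Complex.ofReal_natCast, -Complex.ofReal_one,
      -Complex.ofReal_zero] <;> (try constructor) <;> (try field_simp) <;> (try ring)

/-- `e₂e₂*J = −E₂₂` (p06's `T`). [cite: Goldman1999, §3.1.1] -/
theorem e2_mul_J : vecMulVec ![(0 : ℂ), 0, 1] (star ![(0 : ℂ), 0, 1]) * J = (!![(0 : ℂ), 0, 0; 0, 0, 0; 0, 0, -1] : Matrix (Fin 3) (Fin 3) ℂ) := by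
  ext i j
  fin_cases i <;> fin_cases j <;>
    simp [J, Matrix.mul_apply, Matrix.add_apply, Fin.sum_univ_three, Complex.ext_iff, -Complex.ofReal_div, -Complex.ofReal_mul, -Complex.ofReal_inv,
      -Complex.ofReal_pow, -Complex.ofReal_sub, -Complex.ofReal_add, -Complex.ofReal_neg, -Complex.ofReal_ofNat, -Complex.ofReal_natCast, -Complex.ofReal_one,
      -Complex.ofReal_zero] <;> (try constructor) <;> (try field_simp) <;> (try ring)

/-- The scalars at `t = 0`: `u₀ = ζ`, `iζe^{−(0∕2)i} = iζ`. [cite: Rogawski1990, §8.4 pp. 126–127] -/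
theorem scalars_rep_zero (ζ : Circle) :
    ((ζ * Circle.exp 0 : Circle) : ℂ) = (ζ : ℂ) ∧ I * (ζ : ℂ) * Complex.exp (-((0 : ℝ) / 2 : ℝ) * I) = I * (ζ : ℂ) := by
  refine ⟨by rw [Circle.exp_zero, mul_one], ?_⟩
  rw [zero_div, Complex.ofReal_zero, neg_zero, zero_mul, Complex.exp_zero, mul_one]

/-! ## §2 The line data `P 0, P₁ 0, P₂, h 0, h₁ 0, h₂ 0` at the representative point (`r₀ = s`, `b = 3∕(2s)`, `s ≠ 0`) -/

/-- `P 0 = (r₀² − nsq W)•1 + N = s²•P`. [cite: Rogawski1990, §8.4 pp. 126–127] -/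
theorem P_rep_zero (s : ℝ) :
    (((s ^ 2 - nsq ![(s : ℂ), 0] : ℝ) : ℂ)) • (1 : Matrix (Fin 3) (Fin 3) ℂ) + vecMulVec ![(s : ℂ), 0, (s : ℂ)] (star ![(s : ℂ), 0, (s : ℂ)]) * J =
      ((s ^ 2 : ℝ) : ℂ) • (!![(1 : ℂ), 0, -1; 0, 0, 0; 1, 0, -1] : Matrix (Fin 3) (Fin 3) ℂ) := by
  rw [nsq_rep, sub_self, Complex.ofReal_zero, zero_smul, zero_add, vecMulVec_rep_mul_J]

/-- `P₁ 0 = (2r₀b)•1 + b•((x̂e₂* + e₂x̂*)J + (2r₀)•e₂e₂*J) = 3•1 + (3∕2)•V₀`, `V₀ = E₂₀ − E₀₂ − 2E₂₂`. [cite: Rogawski1990, §8.4 pp. 126–127] -/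
theorem P₁_rep_zero (s : ℝ) (hs : s ≠ 0) :
    ((2 * s * (3 / (2 * s)) : ℝ) : ℂ) • (1 : Matrix (Fin 3) (Fin 3) ℂ) +
        (3 / (2 * s)) • ((vecMulVec ![(s : ℂ), 0, 0] (star ![(0 : ℂ), 0, 1]) + vecMulVec ![(0 : ℂ), 0, 1] (star ![(s : ℂ), 0, 0])) * J +
          (2 * s) • (vecMulVec ![(0 : ℂ), 0, 1] (star ![(0 : ℂ), 0, 1]) * J)) =
      (3 : ℂ) • (1 : Matrix (Fin 3) (Fin 3) ℂ) + ((3 / 2 : ℝ) : ℂ) • (!![(0 : ℂ), 0, -1; 0, 0, 0; 1, 0, -2] : Matrix (Fin 3) (Fin 3) ℂ) := by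
  rw [wallPair_rep_mul_J, e2_mul_J]
  have h3 : (2 * s * (3 / (2 * s)) : ℝ) = 3 := by field_simp
  rw [h3]
  ext i j
  fin_cases i <;> fin_cases j <;>
    simp [J, Matrix.mul_apply, Matrix.add_apply, Fin.sum_univ_three, Complex.ext_iff, -Complex.ofReal_div, -Complex.ofReal_mul, -Complex.ofReal_inv,
      -Complex.ofReal_pow, -Complex.ofReal_sub, -Complex.ofReal_add, -Complex.ofReal_neg, -Complex.ofReal_ofNat, -Complex.ofReal_natCast, -Complex.ofReal_one,
      -Complex.ofReal_zero] <;> (try constructor) <;> (try field_simp) <;> (try ring)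

/-- `P₂ = (2b²)•1 + b•(b•(2•e₂e₂*J)) = (9∕(2s²))•(1 − E₂₂)`. [cite: Rogawski1990, §8.4 pp. 126–127] -/
theorem P₂_rep (s : ℝ) (hs : s ≠ 0) :
    ((2 * (3 / (2 * s)) * (3 / (2 * s)) : ℝ) : ℂ) • (1 : Matrix (Fin 3) (Fin 3) ℂ) +
        (3 / (2 * s)) • ((3 / (2 * s)) • ((2 : ℝ) • (vecMulVec ![(0 : ℂ), 0, 1] (star ![(0 : ℂ), 0, 1]) * J))) =
      ((9 / (2 * s ^ 2) : ℝ) : ℂ) • (!![(1 : ℂ), 0, 0; 0, 1, 0; 0, 0, 0] : Matrix (Fin 3) (Fin 3) ℂ) := by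
  rw [e2_mul_J]
  have h9 : (2 * (3 / (2 * s)) * (3 / (2 * s)) : ℝ) = 9 / (2 * s ^ 2) := by field_simp; ring
  rw [h9]
  ext i j
  fin_cases i <;> fin_cases j <;>
    simp [J, Matrix.mul_apply, Matrix.add_apply, Fin.sum_univ_three, Complex.ext_iff, -Complex.ofReal_div, -Complex.ofReal_mul, -Complex.ofReal_inv,
      -Complex.ofReal_pow, -Complex.ofReal_sub, -Complex.ofReal_add, -Complex.ofReal_neg, -Complex.ofReal_ofNat, -Complex.ofReal_natCast, -Complex.ofReal_one,
      -Complex.ofReal_zero] <;> (try constructor) <;> (try field_simp) <;> (try ring)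

/-- `h 0 = u₀•1 + (iζ)•N = ζ • M₀(s)`, `M₀(s) = 1 + s²•iP` (p06's base point, ★ `UnitBallCentreValueEngineContinuity`). [cite: Rogawski1990, §8.4 pp. 126–127] -/
theorem h_rep_zero (ζ : Circle) (s : ℝ) :
    (ζ : ℂ) • (1 : Matrix (Fin 3) (Fin 3) ℂ) + (I * (ζ : ℂ)) • (vecMulVec ![(s : ℂ), 0, (s : ℂ)] (star ![(s : ℂ), 0, (s : ℂ)]) * J) =
      (ζ : ℂ) • ((1 : Matrix (Fin 3) (Fin 3) ℂ) + (s ^ 2 : ℝ) • (!![Complex.I, (0 : ℂ), (-Complex.I); (0 : ℂ), (0 : ℂ), (0 : ℂ); Complex.I, (0 : ℂ), (-Complex.I)] : Matrix (Fin 3) (Fin 3) ℂ)) := by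
  rw [vecMulVec_rep_mul_J]
  ext i j
  fin_cases i <;> fin_cases j <;>
    simp [J, Matrix.mul_apply, Matrix.add_apply, Fin.sum_univ_three, Complex.ext_iff, -Complex.ofReal_div, -Complex.ofReal_mul, -Complex.ofReal_inv,
      -Complex.ofReal_pow, -Complex.ofReal_sub, -Complex.ofReal_add, -Complex.ofReal_neg, -Complex.ofReal_ofNat, -Complex.ofReal_natCast, -Complex.ofReal_one,
      -Complex.ofReal_zero] <;> (try constructor) <;> (try field_simp) <;> (try ring)

/-- `h₁ 0 = (iu₀)•1 + (iζ)•(b•(pairJ + (2r₀)•e₂e₂*J)) + (−(i∕2)·iζ)•N = ζ•(i•1 + (3i∕2)•V₀ + (s²∕2)•P)`. [cite: Rogawski1990, §8.4 pp. 126–127] -/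
theorem h₁_rep_zero (ζ : Circle) (s : ℝ) (hs : s ≠ 0) :
    (I * (ζ : ℂ)) • (1 : Matrix (Fin 3) (Fin 3) ℂ) +
        ((I * (ζ : ℂ)) • ((3 / (2 * s)) • ((vecMulVec ![(s : ℂ), 0, 0] (star ![(0 : ℂ), 0, 1]) + vecMulVec ![(0 : ℂ), 0, 1] (star ![(s : ℂ), 0, 0])) * J +
            (2 * s) • (vecMulVec ![(0 : ℂ), 0, 1] (star ![(0 : ℂ), 0, 1]) * J))) +
          (-(I / 2) * (I * (ζ : ℂ))) • (vecMulVec ![(s : ℂ), 0, (s : ℂ)] (star ![(s : ℂ), 0, (s : ℂ)]) * J)) =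
      (ζ : ℂ) • (I • (1 : Matrix (Fin 3) (Fin 3) ℂ) + (((3 / 2 : ℝ) : ℂ) * I) • (!![(0 : ℂ), 0, -1; 0, 0, 0; 1, 0, -2] : Matrix (Fin 3) (Fin 3) ℂ) + ((s ^ 2 / 2 : ℝ) : ℂ) • (!![(1 : ℂ), 0, -1; 0, 0, 0; 1, 0, -1] : Matrix (Fin 3) (Fin 3) ℂ)) := by
  rw [wallPair_rep_mul_J, e2_mul_J, vecMulVec_rep_mul_J]
  ext i j
  fin_cases i <;> fin_cases j <;>
    simp [J, Matrix.mul_apply, Matrix.add_apply, Fin.sum_univ_three, Complex.ext_iff, -Complex.ofReal_div, -Complex.ofReal_mul, -Complex.ofReal_inv,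
      -Complex.ofReal_pow, -Complex.ofReal_sub, -Complex.ofReal_add, -Complex.ofReal_neg, -Complex.ofReal_ofNat, -Complex.ofReal_natCast, -Complex.ofReal_one,
      -Complex.ofReal_zero] <;> (try constructor) <;> (try field_simp) <;> (try ring)

/-- `h₂ 0 = (i·i·u₀)•1 + [(iζ)•(b•(b•(2•e₂e₂*J))) + (−(i∕2)iζ)•(b•(pairJ + 2r₀•e₂e₂*J))] + [(−(i∕2)iζ)•(b•(…)) + (−(i∕2))(−(i∕2))(iζ)•N]`
`= ζ•(−1 + (3∕2)•V₀ − (9i∕(2s²))•E₂₂ − (i s²∕4)•P)`. [cite: Rogawski1990, §8.4 pp. 126–127] -/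
theorem h₂_rep_zero (ζ : Circle) (s : ℝ) (hs : s ≠ 0) :
    (I * (I * (ζ : ℂ))) • (1 : Matrix (Fin 3) (Fin 3) ℂ) +
        (((I * (ζ : ℂ)) • ((3 / (2 * s)) • ((3 / (2 * s)) • ((2 : ℝ) • (vecMulVec ![(0 : ℂ), 0, 1] (star ![(0 : ℂ), 0, 1]) * J)))) +
            (-(I / 2) * (I * (ζ : ℂ))) • ((3 / (2 * s)) • ((vecMulVec ![(s : ℂ), 0, 0] (star ![(0 : ℂ), 0, 1]) + vecMulVec ![(0 : ℂ), 0, 1] (star ![(s : ℂ), 0, 0])) * J +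
              (2 * s) • (vecMulVec ![(0 : ℂ), 0, 1] (star ![(0 : ℂ), 0, 1]) * J)))) +
          ((-(I / 2) * (I * (ζ : ℂ))) • ((3 / (2 * s)) • ((vecMulVec ![(s : ℂ), 0, 0] (star ![(0 : ℂ), 0, 1]) + vecMulVec ![(0 : ℂ), 0, 1] (star ![(s : ℂ), 0, 0])) * J +
              (2 * s) • (vecMulVec ![(0 : ℂ), 0, 1] (star ![(0 : ℂ), 0, 1]) * J))) +
            (-(I / 2) * (-(I / 2) * (I * (ζ : ℂ)))) • (vecMulVec ![(s : ℂ), 0, (s : ℂ)] (star ![(s : ℂ), 0, (s : ℂ)]) * J))) =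
      (ζ : ℂ) • (-(1 : Matrix (Fin 3) (Fin 3) ℂ) + ((3 / 2 : ℝ) : ℂ) • (!![(0 : ℂ), 0, -1; 0, 0, 0; 1, 0, -2] : Matrix (Fin 3) (Fin 3) ℂ) + (((-(9 / (2 * s ^ 2)) : ℝ) : ℂ) * I) • (!![(0 : ℂ), 0, 0; 0, 0, 0; 0, 0, 1] : Matrix (Fin 3) (Fin 3) ℂ) +
        (((-(s ^ 2 / 4) : ℝ) : ℂ) * I) • (!![(1 : ℂ), 0, -1; 0, 0, 0; 1, 0, -1] : Matrix (Fin 3) (Fin 3) ℂ)) := by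
  rw [wallPair_rep_mul_J, e2_mul_J, vecMulVec_rep_mul_J]
  ext i j
  fin_cases i <;> fin_cases j <;>
    simp [J, Matrix.mul_apply, Matrix.add_apply, Fin.sum_univ_three, Complex.ext_iff, -Complex.ofReal_div, -Complex.ofReal_mul, -Complex.ofReal_inv,
      -Complex.ofReal_pow, -Complex.ofReal_sub, -Complex.ofReal_add, -Complex.ofReal_neg, -Complex.ofReal_ofNat, -Complex.ofReal_natCast, -Complex.ofReal_one,
      -Complex.ofReal_zero] <;> (try constructor) <;> (try field_simp) <;> (try ring)

end Literature.Geometry.ComplexHyperbolic.BallModel.RepresentativeSlots
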